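import Literature.NumberTheory.Automorphic.UnitaryGroupArchFactor
import Literature.NumberTheory.Automorphic.UnitaryGroupCohomologicalForms
import Literature.AlgebraicGeometry.ShimuraVarieties.UnitaryBallQuotientDatum
import Mathlib.RepresentationTheory.Invariants
import HarnessLib

/-!
# The `(1,0) ⊕ (0,1)` cotangent automorphic forms of a unitary group `U(J)`, `J` hermitian of RANK 2, in CONE coordinates

For a number field `E` with an automorphism `c ≠ 1` over `F` fixing the infinite places (CM situation), a matrix `J ∈ M₂(E)` and ONE
complex place `w₁` of `E` (where `σ_{w₁} J` is meant to have signature `(1,1)`), this file DEFINES — with bodies, over the tree's ★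
adelic unitary group `U(J)(𝔸_F) = (adelicGroupData F E c 2 J).Adelic`, its finite-adelic factor `finAdelic … 2 J`, its archimedean
factor at `w₁` (`adelicSingle w₁ : U(σ_{w₁}J)(ℂ) →* U(J)(𝔸_F)`, ★ `UnitaryGroupArchSection`) and the archimedean factor AWAY from `w₁`
(`(ker archAt w₁).map archToAdelic`, ★ `UnitaryGroupArchFactor`) — the function spaces through which «holomorphic 1-forms on the unitary
Shimura CURVES of `U(J)`, of all levels, read on the adelic group» are spoken about:

* `rightRep₂` — right translation of `U(J)(𝔸_{F,f})` on `ℂ`-valued functions on `U(J)(𝔸_F)` ([BorelJacquet1979, §4.2]);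
* `smoothFun₂` — functions fixed by an open subgroup of `U(J)(𝔸_{F,f})`;
* `conjFun₂` — complex conjugation of functions (conjugate-linear);
* `ConeFrame J w₁` — a NEGATIVE vector `v₀` and a POSITIVE vector `t₀`, `σ_{w₁}J`-orthogonal (a point of the disc of negative lines and a
  cotangent direction at it: [BergeronMillsonMoeglin2016Balls, Part 2 §1.3], the negative cone ★ `negCone`);
* `IsConeHol 𝔣 Φ` — for `Φ : M₂(ℂ) → ℂ`: HOLOMORPHY on the cone-open `{g ∈ GL₂(ℂ) | g v₀ negative}` (ordinary `DifferentiableOn ℂ` on an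
  open subset of `ℂ⁴`) AND the COTANGENT LAW `Φ (g b) = (a c⁻¹) Φ g` whenever `b v₀ = c v₀`, `b t₀ = a t₀ + d v₀` — the law of the cone
  pull-back of a holomorphic 1-form, ★ `UnitaryBallUniformisationDatum.conePullback_of_smul_eq` ([Borel1997, §5.13–§5.14]: forms on the
  quotient ↔ functions on the group with an automorphy factor; restricted to `K_∞ = Stab(ℂ v₀) ≅ U(1) × U(1)` it is the `K_∞`-type of
  the cotangent line of the disc);
* `holCotForms₂ 𝔣` — the HOLOMORPHIC COTANGENT AUTOMORPHIC FORMS: left `U(J)(F)`-invariant, right-invariant under the archimedean factor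
  away from `w₁`, smooth, and whose `w₁`-slice through every adelic point is an `IsConeHol` function ([Borel1997, §5.14];
  [BorelWallach2000, VII 2.10]); `cohForms₂ 𝔣 := holCotForms₂ ⊔ conj holCotForms₂` — the `(1,0) ⊕ (0,1)` forms ([BorelWallach2000, VII 3.6];
  for the unitary Shimura curves the `π^{(1,0)}`∕`π^{(0,1)}` contributions of [Liu2021, App. D l. 5357–5359]).

* §5 the JUNCTION WITH THE HONEST `L²` SPECTRUM (scalar twins of ★ `UnitaryGroupCohomologicalForms` §4): `P.ContainsFun f` — the
  `L²`-class of the scalar form `f` (read on the automorphic quotient through ★ `CotangentForms.toQuotFun`) lies in the discrete automorphic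
  representation `P`; `P.IsHolCotangentAt₂ hc hfix w₁ 𝔣` ∕ `P.IsAntiholCotangentAt₂ …` — `P` contains a non-zero holomorphic (resp.
  antiholomorphic) cotangent form: «`P_∞ = π^{(1,0)}` (resp. `π^{(0,1)}`) at `w₁`» ([Liu2021, App. D l. 5357–5359]; [BorelWallach2000, VII 3.2]).

This is the rank-2, CHART-FREE companion of the rank-3 carriers `Summits/…/Theorems/H413CohFormsCarriers.lean` (which phrase the two
archimedean clauses on the `U(2,1)` ball MODEL via `weightForms` + `holGerms`); here no disc model, no exponential chart and no Cauchy–Riemann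
operator is used.  Definitions with bodies + stability lemmas; no named fact, no instance, no notation, no `sorry`.

## References
* [BorelJacquet1979] A. Borel, H. Jacquet, Corvallis PSPM 33.1, §4.1–§4.2.
* [Borel1997] A. Borel, *Automorphic forms on SL₂(ℝ)*, §5.13–§5.14.
* [BorelWallach2000] A. Borel, N. Wallach, 2nd ed., VII 2.10, 3.6.
* [BergeronMillsonMoeglin2016Balls] N. Bergeron, J. Millson, C. Moeglin, Acta Math. 216 (2016), Part 2 §1.3.
* [Liu2021] Y. Liu, Camb. J. Math. 9 (2021), App. D (FJcycle.tex l. 5350–5359).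
-/

noncomputable section

open NumberField NumberField.InfinitePlace Topology Matrix MeasureTheory

open scoped Matrix MatrixGroups ComplexConjugate ComplexOrder

namespace Literature.NumberTheory.Automorphic

namespace UnitaryCurveForms

open UnitaryGroup Literature.AlgebraicGeometry.ShimuraVarieties

variable (F E : Type) [Field F] [NumberField F] [Field E] [NumberField E] [Algebra F E]
  (c : E ≃ₐ[F] E) (J : Matrix (Fin 2) (Fin 2) E)
  (hc : c ≠ 1) (hfix : ∀ w : InfinitePlace E, c • w = w) (w₁ : {w : InfinitePlace E // IsComplex w})

/-! ## §1 Right translation, smooth vectors, conjugation -/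

/-- **Right translation by the finite-adelic group** on `ℂ`-valued functions on `U(J)(𝔸_F)`: `(R_g f)(x) = f (x · (1, g))`.
[cite: BorelJacquet1979, §4.2] -/
def rightRep₂ : Representation ℂ (finAdelic F E c 2 J) ((adelicGroupData F E c 2 J).Adelic → ℂ) where
  toFun g :=
    { toFun := fun f x => f (x * finAdelicToAdelic F E c 2 J g)
      map_add' := fun _ _ => rfl
      map_smul' := fun _ _ => rfl }
  map_one' := by
    ext f x
    simp
  map_mul' g g' := by
    ext f x
    simp [mul_assoc]

/-- Unfolding of `rightRep₂`. [cite: BorelJacquet1979, §4.2] -/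
theorem rightRep₂_apply (g : finAdelic F E c 2 J) (f : (adelicGroupData F E c 2 J).Adelic → ℂ)
    (x : (adelicGroupData F E c 2 J).Adelic) :
    rightRep₂ F E c J g f x = f (x * finAdelicToAdelic F E c 2 J g) := rfl

/-- **Smooth vectors**: functions fixed (under right translation) by some OPEN subgroup of `U(J)(𝔸_{F,f})`.
[cite: BorelJacquet1979, §4.2] -/
def smoothFun₂ : Submodule ℂ ((adelicGroupData F E c 2 J).Adelic → ℂ) where
  carrier := {f | ∃ Kf : Subgroup (finAdelic F E c 2 J), IsOpen (Kf : Set (finAdelic F E c 2 J)) ∧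
    ∀ k ∈ Kf, ∀ x : (adelicGroupData F E c 2 J).Adelic, f (x * finAdelicToAdelic F E c 2 J k) = f x}
  zero_mem' := ⟨⊤, isOpen_univ, fun _ _ _ => rfl⟩
  add_mem' := by
    rintro f f' ⟨K, hK, hf⟩ ⟨K', hK', hf'⟩
    exact ⟨K ⊓ K', hK.inter hK', fun k hk x => by
      simp only [Pi.add_apply, hf k (Subgroup.mem_inf.1 hk).1 x, hf' k (Subgroup.mem_inf.1 hk).2 x]⟩
  smul_mem' := by
    rintro r f ⟨K, hK, hf⟩
    exact ⟨K, hK, fun k hk x => by simp only [Pi.smul_apply, hf k hk x]⟩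

/-- Membership in `smoothFun₂`, unfolded. [cite: BorelJacquet1979, §4.2] -/
theorem mem_smoothFun₂_iff (f : (adelicGroupData F E c 2 J).Adelic → ℂ) :
    f ∈ smoothFun₂ F E c J ↔ ∃ Kf : Subgroup (finAdelic F E c 2 J), IsOpen (Kf : Set (finAdelic F E c 2 J)) ∧
      ∀ k ∈ Kf, ∀ x : (adelicGroupData F E c 2 J).Adelic, f (x * finAdelicToAdelic F E c 2 J k) = f x :=
  Iff.rfl

/-- Complex conjugation of functions, a conjugate-linear map (holomorphic ↦ antiholomorphic). [cite: BorelWallach2000, VII 2.10] -/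
def conjFun₂ : ((adelicGroupData F E c 2 J).Adelic → ℂ) →ₛₗ[starRingEnd ℂ] ((adelicGroupData F E c 2 J).Adelic → ℂ) where
  toFun f := fun x => star (f x)
  map_add' f f' := by
    funext x
    simp [star_add]
  map_smul' r f := by
    funext x
    simp

/-- `conjFun₂ f x = conj (f x)`. [cite: BorelWallach2000, VII 2.10] -/
theorem conjFun₂_apply (f : (adelicGroupData F E c 2 J).Adelic → ℂ) (x : (adelicGroupData F E c 2 J).Adelic) :
    conjFun₂ F E c J f x = star (f x) := rfl

/-! ## §2 Cone frames and the cone holomorphy-and-cotangent-type condition at `w₁` -/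

/-- **A cone frame at `w₁`**: a NEGATIVE vector `v₀` for `σ_{w₁} J` (a point of the disc of negative lines, ★ `negCone`) and a POSITIVE
vector `t₀`, `σ_{w₁}J`-orthogonal to `v₀` (a cotangent direction at `[v₀]`).  For `σ_{w₁}J` of signature `(1,1)` such frames exist
(columns of a Sylvester frame).  Nothing is asserted by the structure. [cite: BergeronMillsonMoeglin2016Balls, Part 2 §1.3] -/
structure ConeFrame : Type where
  /-- the base negative vector -/
  v₀ : Fin 2 → ℂ
  /-- the positive, orthogonal direction -/
  t₀ : Fin 2 → ℂ
  v₀_mem : v₀ ∈ negCone (J.map w₁.1.embedding)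
  t₀_pos : 0 < (star t₀ ⬝ᵥ (J.map w₁.1.embedding *ᵥ t₀)).re
  orth : star t₀ ⬝ᵥ (J.map w₁.1.embedding *ᵥ v₀) = 0

variable {E J w₁}

/-- **`IsConeHol 𝔣 Φ`** for `Φ : M₂(ℂ) → ℂ`: (i) `Φ` is HOLOMORPHIC on the cone-open set `{g | g invertible, g v₀ negative}` (an open subset
of `ℂ⁴`; `DifferentiableOn ℂ` read through `Matrix.of`), and (ii) the COTANGENT LAW along the stabiliser of the line `ℂ v₀`:
`Φ (g b) = (a c⁻¹) · Φ g` whenever `b v₀ = c v₀` (`c ≠ 0`) and `b t₀ = a t₀ + d v₀` — the law ★ `conePullback_of_smul_eq` proves for the cone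
pull-back `g ↦ α_{ψ(g v₀)}(dψ_{g v₀}(g t₀))` of a holomorphic `1`-form `α` of a disc quotient; on `K_∞ = U(σ_{w₁}J) ∩ Stab(ℂ v₀)` it is
the `K_∞`-type of the cotangent line. [cite: Borel1997, §5.13–§5.14] -/
def IsConeHol (𝔣 : ConeFrame E J w₁) (Φ : Matrix (Fin 2) (Fin 2) ℂ → ℂ) : Prop :=
  DifferentiableOn ℂ (fun g : Fin 2 → Fin 2 → ℂ => Φ (Matrix.of g))
      {g | IsUnit (Matrix.of g) ∧ Matrix.of g *ᵥ 𝔣.v₀ ∈ negCone (J.map w₁.1.embedding)} ∧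
    ∀ (g b : Matrix (Fin 2) (Fin 2) ℂ) (a k d : ℂ), IsUnit g → g *ᵥ 𝔣.v₀ ∈ negCone (J.map w₁.1.embedding) → k ≠ 0 →
      b *ᵥ 𝔣.v₀ = k • 𝔣.v₀ → b *ᵥ 𝔣.t₀ = a • 𝔣.t₀ + d • 𝔣.v₀ → Φ (g * b) = (a * k⁻¹) * Φ g

omit [NumberField E] in
/-- `IsConeHol` is `ℂ`-linear in `Φ`: zero. [cite: Borel1997, §5.13–§5.14] -/
theorem IsConeHol.zero (𝔣 : ConeFrame E J w₁) : IsConeHol 𝔣 0 :=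
  ⟨differentiableOn_const 0, fun _ _ _ _ _ _ _ _ _ _ => by simp⟩

omit [NumberField E] in
/-- `IsConeHol` is `ℂ`-linear in `Φ`: sums. [cite: Borel1997, §5.13–§5.14] -/
theorem IsConeHol.add {𝔣 : ConeFrame E J w₁} {Φ Ψ : Matrix (Fin 2) (Fin 2) ℂ → ℂ} (hΦ : IsConeHol 𝔣 Φ) (hΨ : IsConeHol 𝔣 Ψ) :
    IsConeHol 𝔣 (Φ + Ψ) :=
  ⟨hΦ.1.add hΨ.1, fun g b a k d hg hv hk hb ht => by
    rw [Pi.add_apply, Pi.add_apply, hΦ.2 g b a k d hg hv hk hb ht, hΨ.2 g b a k d hg hv hk hb ht, mul_add]⟩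

omit [NumberField E] in
/-- `IsConeHol` is `ℂ`-linear in `Φ`: scalars. [cite: Borel1997, §5.13–§5.14] -/
theorem IsConeHol.smul {𝔣 : ConeFrame E J w₁} (r : ℂ) {Φ : Matrix (Fin 2) (Fin 2) ℂ → ℂ} (hΦ : IsConeHol 𝔣 Φ) :
    IsConeHol 𝔣 (r • Φ) :=
  ⟨hΦ.1.const_smul r, fun g b a k d hg hv hk hb ht => by
    rw [Pi.smul_apply, Pi.smul_apply, hΦ.2 g b a k d hg hv hk hb ht, smul_eq_mul, smul_eq_mul]; ring⟩

variable (E J w₁)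

/-! ## §3 The carriers -/

/-- **The HOLOMORPHIC COTANGENT AUTOMORPHIC FORMS of `U(J)` at the cone frame `𝔣`** (`(1,0)`-forms of all levels on the unitary Shimura
curves of `U(J)`, read on the adelic group): `ℂ`-valued functions `f` on `U(J)(𝔸_F)` that are (L) LEFT-invariant under `U(J)(F)`,
(Kc) right-invariant under the archimedean factor AWAY from `w₁`, (Sm) smooth under `U(J)(𝔸_{F,f})`, and (H) whose `w₁`-SLICE through
every adelic point `x`, `u ↦ f (x · adelicSingle w₁ u)` (RIGHT translation, as ★ `weightForms` ∕ `holGerms` at rank 3) on `U(σ_{w₁}J)(ℂ) ≤ GL₂(ℂ)`, is the restriction of an `IsConeHol` function on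
`M₂(ℂ)` (holomorphic on the cone-open, with the cotangent law). [cite: Borel1997, §5.14] [cite: BorelWallach2000, VII 2.10]
[cite: BorelJacquet1979, §4.2] -/
def holCotForms₂ (𝔣 : ConeFrame E J w₁) : Submodule ℂ ((adelicGroupData F E c 2 J).Adelic → ℂ) where
  carrier := {f | (∀ (γ : (adelicGroupData F E c 2 J).Rational) (x : (adelicGroupData F E c 2 J).Adelic),
      f ((adelicGroupData F E c 2 J).toAdelic γ * x) = f x) ∧
    (∀ k ∈ ((archAt F E c 2 J w₁ (hfix w₁.1) hc).ker).map (archToAdelic F E c 2 J),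
      ∀ x : (adelicGroupData F E c 2 J).Adelic, f (x * k) = f x) ∧
    f ∈ smoothFun₂ F E c J ∧
    ∀ x : (adelicGroupData F E c 2 J).Adelic, ∃ Φ : Matrix (Fin 2) (Fin 2) ℂ → ℂ, IsConeHol 𝔣 Φ ∧
      ∀ u : archLocal E 2 J w₁, Φ ((u : GL (Fin 2) ℂ) : Matrix (Fin 2) (Fin 2) ℂ) = f (x * adelicSingle F E c 2 J hc hfix w₁ u)}
  zero_mem' := ⟨fun _ _ => rfl, fun _ _ _ => rfl, Submodule.zero_mem _, fun _ => ⟨0, IsConeHol.zero 𝔣, fun _ => rfl⟩⟩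
  add_mem' := by
    rintro f f' ⟨hfL, hfK, hfS, hfH⟩ ⟨hgL, hgK, hgS, hgH⟩
    refine ⟨fun γ x => by simp only [Pi.add_apply, hfL γ x, hgL γ x],
      fun k hk x => by simp only [Pi.add_apply, hfK k hk x, hgK k hk x], Submodule.add_mem _ hfS hgS, fun x => ?_⟩
    obtain ⟨Φ, hΦ, hΦf⟩ := hfH x
    obtain ⟨Ψ, hΨ, hΨf⟩ := hgH x
    exact ⟨Φ + Ψ, hΦ.add hΨ, fun u => by simp only [Pi.add_apply, hΦf u, hΨf u]⟩
  smul_mem' := by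
    rintro r f ⟨hfL, hfK, hfS, hfH⟩
    refine ⟨fun γ x => by simp only [Pi.smul_apply, hfL γ x], fun k hk x => by simp only [Pi.smul_apply, hfK k hk x],
      Submodule.smul_mem _ r hfS, fun x => ?_⟩
    obtain ⟨Φ, hΦ, hΦf⟩ := hfH x
    exact ⟨r • Φ, hΦ.smul r, fun u => by simp only [Pi.smul_apply, hΦf u]⟩

/-- Membership in `holCotForms₂`, unfolded. [cite: Borel1997, §5.14] -/
theorem mem_holCotForms₂_iff (𝔣 : ConeFrame E J w₁) (f : (adelicGroupData F E c 2 J).Adelic → ℂ) :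
    f ∈ holCotForms₂ F E c J hc hfix w₁ 𝔣 ↔
      (∀ (γ : (adelicGroupData F E c 2 J).Rational) (x : (adelicGroupData F E c 2 J).Adelic),
      f ((adelicGroupData F E c 2 J).toAdelic γ * x) = f x) ∧
      (∀ k ∈ ((archAt F E c 2 J w₁ (hfix w₁.1) hc).ker).map (archToAdelic F E c 2 J),
        ∀ x : (adelicGroupData F E c 2 J).Adelic, f (x * k) = f x) ∧
      f ∈ smoothFun₂ F E c J ∧
      ∀ x : (adelicGroupData F E c 2 J).Adelic, ∃ Φ : Matrix (Fin 2) (Fin 2) ℂ → ℂ, IsConeHol 𝔣 Φ ∧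
        ∀ u : archLocal E 2 J w₁, Φ ((u : GL (Fin 2) ℂ) : Matrix (Fin 2) (Fin 2) ℂ) = f (x * adelicSingle F E c 2 J hc hfix w₁ u) :=
  Iff.rfl

/-- **The `(1,0) ⊕ (0,1)` COHOMOLOGICAL COTANGENT AUTOMORPHIC FORMS**: holomorphic cotangent forms and their complex conjugates (the two
Hodge types of degree `1` on the unitary Shimura curves). [cite: BorelWallach2000, VII 2.10 and 3.6] [cite: Liu2021, App. D l. 5357–5359] -/
def cohForms₂ (𝔣 : ConeFrame E J w₁) : Submodule ℂ ((adelicGroupData F E c 2 J).Adelic → ℂ) :=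
  holCotForms₂ F E c J hc hfix w₁ 𝔣 ⊔ (holCotForms₂ F E c J hc hfix w₁ 𝔣).map (conjFun₂ F E c J)

/-! ## §4 Stability under finite-adelic right translation -/

/-- Right translation by `g ∈ U(J)(𝔸_{F,f})` preserves smoothness (the fixing subgroup is conjugated by `g`).
[cite: BorelJacquet1979, §4.2] -/
theorem rightRep₂_mem_smoothFun₂ (g : finAdelic F E c 2 J) {f : (adelicGroupData F E c 2 J).Adelic → ℂ}
    (hf : f ∈ smoothFun₂ F E c J) : rightRep₂ F E c J g f ∈ smoothFun₂ F E c J := by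
  obtain ⟨K, hK, hfK⟩ := hf
  refine ⟨K.comap (MulAut.conj g⁻¹).toMonoidHom, ?_, fun k hk x => ?_⟩
  · rw [Subgroup.coe_comap]
    exact hK.preimage ((continuous_const.mul continuous_id).mul continuous_const)
  · have hk' : g⁻¹ * k * g⁻¹⁻¹ ∈ K := hk
    rw [inv_inv] at hk'
    simp only [rightRep₂_apply, mul_assoc, ← map_mul]
    have h := hfK _ hk' (x * finAdelicToAdelic F E c 2 J g)
    rw [mul_assoc, ← map_mul] at h
    simpa [mul_assoc] using h

/-- Right translation by `g ∈ U(J)(𝔸_{F,f})` preserves `holCotForms₂` (the finite-adelic factor commutes with both archimedean factors: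
★ `adelicSingle_mul_finAdelicToAdelic`, ★ `mul_finAdelicToAdelic_of_mem_map_ker_archAt`). [cite: BorelJacquet1979, §4.2] -/
theorem rightRep₂_mem_holCotForms₂ (𝔣 : ConeFrame E J w₁) (g : finAdelic F E c 2 J) {f : (adelicGroupData F E c 2 J).Adelic → ℂ}
    (hf : f ∈ holCotForms₂ F E c J hc hfix w₁ 𝔣) : rightRep₂ F E c J g f ∈ holCotForms₂ F E c J hc hfix w₁ 𝔣 := by
  obtain ⟨hL, hK, hS, hH⟩ := hf
  refine ⟨fun γ x => ?_, fun k hk x => ?_, rightRep₂_mem_smoothFun₂ F E c J g hS, fun x => ?_⟩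
  · rw [rightRep₂_apply, rightRep₂_apply, mul_assoc, hL]
  · rw [rightRep₂_apply, rightRep₂_apply, mul_assoc, mul_finAdelicToAdelic_of_mem_map_ker_archAt F E c 2 J hc hfix w₁ k hk g,
      ← mul_assoc, hK k hk]
  · obtain ⟨Φ, hΦ, hΦf⟩ := hH (x * finAdelicToAdelic F E c 2 J g)
    exact ⟨Φ, hΦ, fun u => by
      rw [rightRep₂_apply, mul_assoc, adelicSingle_mul_finAdelicToAdelic F E c 2 J hc hfix w₁ u g, ← mul_assoc, hΦf u]⟩

/-- Conjugation commutes with right translation. [cite: BorelWallach2000, VII 2.10] -/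
theorem conjFun₂_rightRep₂ (g : finAdelic F E c 2 J) (f : (adelicGroupData F E c 2 J).Adelic → ℂ) :
    conjFun₂ F E c J (rightRep₂ F E c J g f) = rightRep₂ F E c J g (conjFun₂ F E c J f) := rfl

/-- Right translation by `g ∈ U(J)(𝔸_{F,f})` preserves `cohForms₂`. [cite: BorelWallach2000, VII 2.10 and 3.6] -/
theorem rightRep₂_mem_cohForms₂ (𝔣 : ConeFrame E J w₁) (g : finAdelic F E c 2 J) {f : (adelicGroupData F E c 2 J).Adelic → ℂ}
    (hf : f ∈ cohForms₂ F E c J hc hfix w₁ 𝔣) : rightRep₂ F E c J g f ∈ cohForms₂ F E c J hc hfix w₁ 𝔣 := by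
  obtain ⟨f₁, hf₁, f₂, hf₂, rfl⟩ := Submodule.mem_sup.1 hf
  obtain ⟨f₀, hf₀, rfl⟩ := Submodule.mem_map.1 hf₂
  rw [map_add]
  refine Submodule.mem_sup.2 ⟨_, rightRep₂_mem_holCotForms₂ F E c J hc hfix w₁ 𝔣 g hf₁, _,
    Submodule.mem_map.2 ⟨_, rightRep₂_mem_holCotForms₂ F E c J hc hfix w₁ 𝔣 g hf₀, conjFun₂_rightRep₂ F E c J g f₀⟩, rfl⟩

/-- `holCotForms₂ ≤ cohForms₂`. [cite: BorelWallach2000, VII 3.6] -/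
theorem holCotForms₂_le_cohForms₂ (𝔣 : ConeFrame E J w₁) :
    holCotForms₂ F E c J hc hfix w₁ 𝔣 ≤ cohForms₂ F E c J hc hfix w₁ 𝔣 :=
  le_sup_left

/-- The conjugate of a holomorphic cotangent form is a cohomological form. [cite: BorelWallach2000, VII 3.6] -/
theorem conjFun₂_mem_cohForms₂ (𝔣 : ConeFrame E J w₁) {f : (adelicGroupData F E c 2 J).Adelic → ℂ}
    (hf : f ∈ holCotForms₂ F E c J hc hfix w₁ 𝔣) : conjFun₂ F E c J f ∈ cohForms₂ F E c J hc hfix w₁ 𝔣 :=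
  Submodule.mem_sup_right (Submodule.mem_map.2 ⟨f, hf, rfl⟩)


/-! ## §5 The junction with the honest `L²` spectrum (scalar twins of ★ `UnitaryGroupCohomologicalForms` §4) -/

section Spectrum

variable {K : Type} [Field K] [NumberField K] {𝒢 : AdelicGroupData.{0} K}
variable {μ : Measure 𝒢.automorphicQuotient} [SMulInvariantMeasure 𝒢.Adelic 𝒢.automorphicQuotient μ]

/-- **`P.ContainsFun f`** — the `L²`-class of the SCALAR function `f` on `G(𝔸_K)` (read on the automorphic quotient through ★
`CotangentForms.toQuotFun`) is square-integrable and LIES IN the discrete automorphic representation `P ⊂ L²(G(𝔸) ⧸ A_G G(K), μ)`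
(Mathlib `MemLp.toLp`); the scalar twin of ★ `DiscreteAutomorphicRep.ContainsForm`. [cite: BorelJacquet1979, §4.6] [cite: BorelWallach2000, VII 3.2] -/
def _root_.Literature.NumberTheory.Automorphic.DiscreteAutomorphicRep.ContainsFun (P : DiscreteAutomorphicRep 𝒢 μ)
    (f : 𝒢.Adelic → ℂ) : Prop :=
  ∃ h : MemLp (CotangentForms.toQuotFun 𝒢 f) 2 μ, MemLp.toLp (CotangentForms.toQuotFun 𝒢 f) h ∈ P.space.toSubmodule

end Spectrum

section HodgeType

variable {F E c J}
variable {μ : Measure (adelicGroupData F E c 2 J).automorphicQuotient}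
  [SMulInvariantMeasure (adelicGroupData F E c 2 J).Adelic (adelicGroupData F E c 2 J).automorphicQuotient μ]

/-- **`P.IsHolCotangentAt₂ hc hfix w₁ 𝔣` — `P` is H¹-COHOMOLOGICAL OF HODGE TYPE `(1,0)` at `w₁`**: the discrete automorphic representation
`P` of `U(J)` contains (the `L²`-class of) a NON-ZERO holomorphic cotangent form `f ∈ holCotForms₂ 𝔣` («`P_∞ = π^{(1,0)}_{1,1} ⊗ 1 ⊗ ⋯`»,
[Liu2021, App. D l. 5357–5359]; the `(1,0)`-summands of Matsushima's formula, [BorelWallach2000, VII 3.2∕3.6]). Scalar twin of ★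
`DiscreteAutomorphicRep.IsHolCotangentAt`. [cite: Liu2021, App. D l. 5357–5359] [cite: BorelWallach2000, VII 3.2 and 3.6] -/
def _root_.Literature.NumberTheory.Automorphic.DiscreteAutomorphicRep.IsHolCotangentAt₂
    (P : DiscreteAutomorphicRep (adelicGroupData F E c 2 J) μ)
    (hc : c ≠ 1) (hfix : ∀ w : InfinitePlace E, c • w = w) (w₁ : {w : InfinitePlace E // IsComplex w}) (𝔣 : ConeFrame E J w₁) : Prop :=
  ∃ f ∈ holCotForms₂ F E c J hc hfix w₁ 𝔣, f ≠ 0 ∧ P.ContainsFun f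

/-- **`P.IsAntiholCotangentAt₂ hc hfix w₁ 𝔣` — `P` is H¹-COHOMOLOGICAL OF HODGE TYPE `(0,1)` at `w₁`**: `P` contains a non-zero
ANTIHOLOMORPHIC cotangent form, i.e. a member of the `conjFun₂`-image of `holCotForms₂ 𝔣` («`P_∞ = π^{(0,1)}_{1,1} ⊗ 1 ⊗ ⋯`»). Scalar twin
of ★ `DiscreteAutomorphicRep.IsAntiholCotangentAt`. [cite: Liu2021, App. D l. 5357–5359] [cite: BorelWallach2000, VII 2.10, 3.2 and 3.6] -/
def _root_.Literature.NumberTheory.Automorphic.DiscreteAutomorphicRep.IsAntiholCotangentAt₂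
    (P : DiscreteAutomorphicRep (adelicGroupData F E c 2 J) μ)
    (hc : c ≠ 1) (hfix : ∀ w : InfinitePlace E, c • w = w) (w₁ : {w : InfinitePlace E // IsComplex w}) (𝔣 : ConeFrame E J w₁) : Prop :=
  ∃ f ∈ (holCotForms₂ F E c J hc hfix w₁ 𝔣).map (conjFun₂ F E c J), f ≠ 0 ∧ P.ContainsFun f

/-- Unfolding of `IsHolCotangentAt₂`. [cite: BorelWallach2000, VII 3.2] -/
theorem _root_.Literature.NumberTheory.Automorphic.DiscreteAutomorphicRep.isHolCotangentAt₂_iff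
    (P : DiscreteAutomorphicRep (adelicGroupData F E c 2 J) μ)
    (hc : c ≠ 1) (hfix : ∀ w : InfinitePlace E, c • w = w) (w₁ : {w : InfinitePlace E // IsComplex w}) (𝔣 : ConeFrame E J w₁) :
    P.IsHolCotangentAt₂ hc hfix w₁ 𝔣 ↔ ∃ f ∈ holCotForms₂ F E c J hc hfix w₁ 𝔣, f ≠ 0 ∧ P.ContainsFun f :=
  Iff.rfl

end HodgeType

end UnitaryCurveForms

end Literature.NumberTheory.Automorphic

end
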